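import Summits.BirchSwinnertonDyer.BirchSwinnertonDyer.Theorems.CountingDoorF2AtThreeSelmerNineKernel
import Summits.BirchSwinnertonDyer.BirchSwinnertonDyer.Theorems.CountingDoorF2AtThreeCountingBridge
import Summits.BirchSwinnertonDyer.BirchSwinnertonDyer.Theorems.CountingDoorF2AtThreeGenericMembers
import Summits.BirchSwinnertonDyer.BirchSwinnertonDyer.Theorems.CountingDoorF2AtThreeSchneiderOnDoorSubfamily
import HarnessLib

/-!
# BirchSwinnertonDyer / CountingDoorF2AtThree — support for crux I1 `SelmerThreeAverageLargeF2`
# (stmt-BirchSwinnertonDyer-19440): PROVED REPLACEMENT LEVERS for the open pair I1 / I2, BY NAME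

Route `route-BirchSwinnertonDyer-CountingDoorF2AtThree` (cell bsd-rank2; TWIN leaf
`PAdicBSDRankTwoPositiveProportion`; rev 11: `closes hBL hIn hL h0 h1 h2 h4`, with I0
`GenericMembersLargeF2` (p435551), `CountingBridgeLoc` (p450499) and I4loc `SchneiderOnDoorSubfamily`
(p463209) PROVED, so the leaf hinges on the fact packs and the two XL cruxes I1
`SelmerThreeAverageLargeF2`, I2 `RootNumberPlusLowerDensityLargeF2`). This file states, in the
route's own names, how much of I1 and I2 the door actually consumes, using the route-free kernel
`CountingDoorF2AtThreeSelmerNineKernel` (capped first moment; `#Sel₃ = 9` density; the door consumes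
only that density) and the landed closers:

* **I1cap** (capped `3`-Selmer average): `∀ Φ large, Φ.AverageOnLE (fun a ↦ min #Sel₃(E_a) 81) 36`.
  `selmerThreeCappedAverage_of_selmerThreeAverageLargeF2 : I1 → I1cap` (§1).
* **D9** (nine-density): `∀ Φ large with nonempty residue sets, the members with #Sel₃(E_a) = 9
  have positive lower density`. §2: `selmerNineDensity_of_cappedAverage : LargeFamilyInputsF2 →
  D–D parity → I1cap → I2 → D9` (first moment + parity on the `100 %` set of I0; K2/K3).
* §3 **D9 alone closes the leaf** (no root number, no parity, no average):
  `countingDoor_leaf_of_local_selmerNine` / `leaf_of_local_selmerNine` (Φ-local, parametric, as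
  `Theorems.countingDoor_leaf_of_local` / `leaf_of_local`) and, BY NAME with the landed I0 and I4loc,
  `pAdicBSDRankTwoPositiveProportion_of_selmerNineDensity :
  PublishedInputsAtThree → LargeFamilyInputsF2 → D9 → PAdicBSDRankTwoPositiveProportion`.
* §4 the capped forms of the bridge: `countingDoor_leaf_of_local_capped`, `leaf_of_local_capped`,
  `pAdicBSDRankTwoPositiveProportion_of_cappedAverage :
  PublishedInputsAtThree → LargeFamilyInputsF2 → I1cap → I2 → PAdicBSDRankTwoPositiveProportion`,
  and the rev-11 chain recovered through them (`…_of_selmerThreeAverageLargeF2`).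
* §5 what D9 gives for free: `rootNumberPlusPositiveDensity_of_selmerNineDensity` (D9 ⇒ the `ρ > 0`
  half of I2, by parity — D9 does not evade root-number POSITIVITY, only the threshold `1/6` and the
  first moment) and `weakLeaf_of_selmerNineDensity` / `weakLeaf_all_of_selmerNineDensity` (D9 ⇒
  `rank = 2 ∧ Ш[3^∞] = 0` for a positive proportion of every large `Φ`, in particular of `F₂`,
  modulo `LargeFamilyInputsF2` ONLY — no Iwasawa theory).

So, modulo the route's two fact packs, `I1 ⇒ I1cap`, `I1cap ∧ I2 ⇒ D9`, `D9 ⇒ leaf` are THEOREMS: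
the planner may replace the pair {I1 (XL), I2 (XL)} by the single strictly weaker crux D9 (a
statement about the DISTRIBUTION of `#Sel₃` on the door family — the `p = 3`, two-marked-points
analogue of "a positive proportion of elliptic curves has rank `0`", Bhargava–Shankar 2015 — with
no tail/uniformity content and no root-number equidistribution), or I1 by I1cap. Nothing here is
S0 motion and nothing reads an analytic rank (B1); the open content is untouched, only re-measured.
No new definition; no named fact beyond the explicit hypotheses; standard axioms. PARTITION: none —
r_an ≥ 2, summit axis S0; TWIN (D-0056): n/a.

References: M. Bhargava, A. Shankar, Ann. of Math. 181 (2015) §1 [BhargavaShankarTernary2015];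
M. Bhargava, W. Ho, arXiv:2207.03309 (2022) Thm. 1.2, Thm. 10.1 [BhargavaHo2022]; T. and
V. Dokchitser, Ann. of Math. 172 (2010) [DokchitserDokchitserAnnals2010]; B. Poonen, E. Rains,
J. AMS 25 (2012) [PoonenRains2012].
-/

set_option linter.dupNamespace false

noncomputable section

open scoped Classical
open Filter Topology
open WeierstrassCurve Literature.NumberTheory.EllipticCurves
  Literature.NumberTheory.EllipticCurves.ModularForms CongruenceSubgroup
  Literature.NumberTheory.EllipticCurves.BhargavaHo2022
  Summit.BirchSwinnertonDyer.Rank2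
  Summit.BirchSwinnertonDyer.BirchSwinnertonDyer.Theses.CountingDoorF2AtThree

namespace Summit.BirchSwinnertonDyer.BirchSwinnertonDyer.Theorems

/-! ### §1 I1 ⇒ I1cap -/

/-- **I1 implies its capped form**: `SelmerThreeAverageLargeF2` gives, on every large `Φ ⊆ F₂`,
`limsup avg min(#Sel₃(E_a), 81) ≤ 36` (`min ≤ #Sel₃` member-wise). The capped form is all the
first-moment door consumes (§4). [cite: BhargavaShankarTernary2015, §1 (first-moment method)] -/
theorem selmerThreeCappedAverage_of_selmerThreeAverageLargeF2 (h1 : SelmerThreeAverageLargeF2)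
    (Φ : CongruenceFamily₂) (hL : Φ.IsLarge) :
    Φ.AverageOnLE (fun a ↦ min (Nat.card (a.curve.selmerGroup 3) : ℝ) 81) 36 :=
  averageOnLE_min Φ (h1 Φ hL) 81

/-! ### §2 I1cap ∧ I2 ⇒ D9 (first moment + parity, on the `100 %` set of I0) -/

/-- **D9 from the capped average and the root-number density** (modulo the large-family facts and
Dokchitser–Dokchitser `3`-parity): if on every large `Φ` the capped `3`-Selmer average is `≤ 36`
(I1cap) and on every large `Φ` with nonempty residue sets the root number is `+1` with lower density
`ρ > 1/6` (I2), then on every large `Φ` with nonempty residue sets the members with `#Sel₃(E_a) = 9`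
have positive lower density (D9). Trivial torsion and `rank ≥ 2` for `100 %` come from I0
(`Theorems.genericMembersLargeF2`, landed) under `LargeFamilyInputsF2`; the count is the kernel's
`hasPositiveLowerDensityOn_selmerNine_of_cappedAverage` with `A = 36`, `36 < 27 + 54ρ`.
[cite: BhargavaShankarTernary2015, §1 (first-moment method with parity)] -/
theorem selmerNineDensity_of_cappedAverage (hLF : LargeFamilyInputsF2)
    (hDD : even_selmerRank_sub_torsionRank_iff)
    (h1 : ∀ Φ : CongruenceFamily₂, Φ.IsLarge →
      Φ.AverageOnLE (fun a ↦ min (Nat.card (a.curve.selmerGroup 3) : ℝ) 81) 36)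
    (h2 : RootNumberPlusLowerDensityLargeF2) (Φ : CongruenceFamily₂) (hL : Φ.IsLarge)
    (hne : ∀ p : ℕ, p.Prime → (Φ.residues p).Nonempty) :
    Φ.HasPositiveLowerDensityOn (fun a ↦ Nat.card (a.curve.selmerGroup 3) = 9) := by
  obtain ⟨ρ, hρ6, hW⟩ := h2 Φ hL hne
  have hGood := hasDensityOn_rank_torsionBy_of_torsionOrder Φ 3 (genericMembersLargeF2 hLF Φ hL hne)
  exact hasPositiveLowerDensityOn_selmerNine_of_cappedAverage Φ hDD hGood (h1 Φ hL) hW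
    (by linarith) (by linarith)

/-! ### §3 D9 alone closes the leaf (no root number, no parity, no average) -/

/-- **The counting door from the nine-density, LOCAL and PARAMETRIC form.** Let `Φ ⊆ F₂` be a
subfamily every member of which has irreducible `ρ̄₃` and all its globally minimal models good
ordinary at `3` with an auxiliary multiplicative prime `ℓ ≠ 3`, `3 ∤ v_ℓ(Δ_min)` (the door family).
Suppose, ON `Φ` ONLY: `rank ≥ 2` for `100 %`, Schneider at `3` for `100 %` of the rank-two minimal
models, and the members with `#Sel₃(E_a) = 9` have positive lower density. Then, modulo the
published inputs at `3` (only Schneider 1985 / Perrin-Riou, Mazur–Tate `σ`, Skinner–Urban are used;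
the parity conjunct is idle), the leaf's property has positive lower density in `Φ`: the `100 %`
set meets the nine-density set in positive lower density, and on the intersection the per-member
door `Theorems.countingDoor_leaf_of_member` applies. [cite: SkinnerUrban2014, Thm 3.29 (per-member door); BhargavaShankarTernary2015, §1 (positive proportion)] -/
theorem countingDoor_leaf_of_local_selmerNine (Φ : CongruenceFamily₂)
    (hloc : ∀ a : Params, Φ.Mem a → a.curve.HasIrreducibleModPGaloisRep 3 ∧
      ∀ (C : VariableChange ℚ) (hC : (C • a.curve).IsGloballyMinimal),
        @IsOrdinaryAt (C • a.curve) hC 3 _ ∧ ∃ ℓ : ℕ, ∃ _ : Fact ℓ.Prime, ℓ ≠ 3 ∧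
          (C • a.curve).HasMultiplicativeReductionAtPrime ℓ ∧
          ¬ 3 ∣ padicValInt ℓ (@minimalDiscriminantInt (C • a.curve) hC))
    (hIn : PublishedInputsAtThree) (hGen : Φ.HasDensityOn (fun a ↦ 2 ≤ a.curve.mordellWeilRank) 1)
    (hSchD : Φ.HasDensityOn (fun a ↦ ∀ (C : WeierstrassCurve.VariableChange ℚ)
      (hC : (C • a.curve).IsGloballyMinimal), @IsOrdinaryAt (C • a.curve) hC 3 _ →
      (C • a.curve).mordellWeilRank = 2 → ∀ Dh : PAdicHeightData (C • a.curve) 3, Dh.IsCanonical →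
      SchneiderConjecture Dh) 1)
    (hD9 : Φ.HasPositiveLowerDensityOn (fun a ↦ Nat.card (a.curve.selmerGroup 3) = 9)) :
    Φ.HasPositiveLowerDensityOn fun a ↦ a.IsMember ∧
      ∃ (C : WeierstrassCurve.VariableChange ℚ) (hC : (C • a.curve).IsGloballyMinimal),
        @IsOrdinaryAt (C • a.curve) hC 3 _ ∧ (C • a.curve).mordellWeilRank = 2 ∧
        AddCommGroup.primaryComponent (C • a.curve).sha 3 = ⊥ ∧
        ∀ ⦃N : ℕ⦄ [NeZero N] (f : CuspForm (Gamma0 N) 2), IsNewformOf (C • a.curve) f →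
          (padicLFunction f (@unitRoot (C • a.curve) hC 3 _ : ℚ_[3])).order = 2 := by
  obtain ⟨h85, hex, -, hSU⟩ := hIn
  have hGood := hasDensityOn_one_and Φ hGen hSchD
  have hD : Φ.HasPositiveLowerDensityOn (fun a ↦ Nat.card (a.curve.selmerGroup 3) = 3 ^ 2) :=
    hasPositiveLowerDensityOn_mono Φ hD9 fun a h ↦ h.trans (by norm_num)
  exact hasPositiveLowerDensityOn_of_door_of_card_selmerGroup_eq_sq Φ hGood hD
    fun a hmem hgood hSel ↦ countingDoor_leaf_of_member h85 hex hSU a hmem.1 (hloc a hmem).2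
      hgood.1 (hloc a hmem).1 hgood.2 hSel

/-- **The leaf from Φ-LOCAL nine-density data**: a large `Φ ⊆ F₂` with the member-wise door
conditions on which `rank ≥ 2` holds for `100 %`, Schneider at `3` holds for `100 %` of the rank-two
minimal models, and `#Sel₃ = 9` has positive lower density witnesses `PAdicBSDRankTwoPositiveProportion`
(modulo the published inputs at `3`). [cite: BhargavaShankarTernary2015, §1 (positive proportion)] -/
theorem leaf_of_local_selmerNine (Φ : CongruenceFamily₂) (hL : Φ.IsLarge)
    (hloc : ∀ a : Params, Φ.Mem a → a.curve.HasIrreducibleModPGaloisRep 3 ∧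
      ∀ (C : VariableChange ℚ) (hC : (C • a.curve).IsGloballyMinimal),
        @IsOrdinaryAt (C • a.curve) hC 3 _ ∧ ∃ ℓ : ℕ, ∃ _ : Fact ℓ.Prime, ℓ ≠ 3 ∧
          (C • a.curve).HasMultiplicativeReductionAtPrime ℓ ∧
          ¬ 3 ∣ padicValInt ℓ (@minimalDiscriminantInt (C • a.curve) hC))
    (hIn : PublishedInputsAtThree) (hGen : Φ.HasDensityOn (fun a ↦ 2 ≤ a.curve.mordellWeilRank) 1)
    (hSchD : Φ.HasDensityOn (fun a ↦ ∀ (C : WeierstrassCurve.VariableChange ℚ)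
      (hC : (C • a.curve).IsGloballyMinimal), @IsOrdinaryAt (C • a.curve) hC 3 _ →
      (C • a.curve).mordellWeilRank = 2 → ∀ Dh : PAdicHeightData (C • a.curve) 3, Dh.IsCanonical →
      SchneiderConjecture Dh) 1)
    (hD9 : Φ.HasPositiveLowerDensityOn (fun a ↦ Nat.card (a.curve.selmerGroup 3) = 9)) :
    PAdicBSDRankTwoPositiveProportion :=
  ⟨Φ, hL, countingDoor_leaf_of_local_selmerNine Φ hloc hIn hGen hSchD hD9⟩

/-- **D9 closes the leaf, BY NAME** (with the landed I0 `Theorems.genericMembersLargeF2` and I4loc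
`Theorems.schneiderOnDoorSubfamily`): modulo the two fact packs `PublishedInputsAtThree`,
`LargeFamilyInputsF2`, if in every large subfamily of `F₂` with nonempty residue sets the members
with `#Sel₃(E_a) = 9` have positive lower density, then `PAdicBSDRankTwoPositiveProportion`. Neither
the `3`-Selmer average (I1) nor the root-number density (I2) nor Dokchitser–Dokchitser parity is
used. [cite: BhargavaShankarTernary2015, §1 (positive proportion); SkinnerUrban2014, Thm 3.29 (per-member door)] -/
theorem pAdicBSDRankTwoPositiveProportion_of_selmerNineDensity (hIn : PublishedInputsAtThree)
    (hLF : LargeFamilyInputsF2)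
    (hD9 : ∀ Φ : CongruenceFamily₂, Φ.IsLarge → (∀ p : ℕ, p.Prime → (Φ.residues p).Nonempty) →
      Φ.HasPositiveLowerDensityOn (fun a ↦ Nat.card (a.curve.selmerGroup 3) = 9)) :
    PAdicBSDRankTwoPositiveProportion := by
  obtain ⟨Φ, hL, hne, hloc, hSchD⟩ := schneiderOnDoorSubfamily
  have hGen : Φ.HasDensityOn (fun a ↦ 2 ≤ a.curve.mordellWeilRank) 1 :=
    hasDensityOn_one_mono Φ (genericMembersLargeF2 hLF Φ hL hne) fun _ h ↦ h.2
  exact leaf_of_local_selmerNine Φ hL hloc hIn hGen hSchD (hD9 Φ hL hne)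

/-! ### §4 The capped forms of the bridge -/

/-- **The counting door on a given family from the CAPPED average** (Φ-local, parametric; same
hypotheses as `Theorems.countingDoor_leaf_of_local` except that only
`limsup avg min(#Sel₃(E_a), 81) ≤ A` is asked): member-wise `hirr` gives `#E(ℚ)[3] = 1`, the kernel
gives the nine-density from the capped average and `w = +1` with lower density `≥ ρ > 0`,
`A < 27 + 54ρ` (this is where D–D parity is used), and §3 closes. [cite: BhargavaShankarTernary2015, §1 (first-moment method with parity)] -/
theorem countingDoor_leaf_of_local_capped (Φ : CongruenceFamily₂)
    (hloc : ∀ a : Params, Φ.Mem a → a.curve.HasIrreducibleModPGaloisRep 3 ∧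
      ∀ (C : VariableChange ℚ) (hC : (C • a.curve).IsGloballyMinimal),
        @IsOrdinaryAt (C • a.curve) hC 3 _ ∧ ∃ ℓ : ℕ, ∃ _ : Fact ℓ.Prime, ℓ ≠ 3 ∧
          (C • a.curve).HasMultiplicativeReductionAtPrime ℓ ∧
          ¬ 3 ∣ padicValInt ℓ (@minimalDiscriminantInt (C • a.curve) hC))
    (hIn : PublishedInputsAtThree) (hGen : Φ.HasDensityOn (fun a ↦ 2 ≤ a.curve.mordellWeilRank) 1)
    {A ρ : ℝ} (hA : Φ.AverageOnLE (fun a ↦ min (Nat.card (a.curve.selmerGroup 3) : ℝ) 81) A)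
    (hW : Φ.DensityOnGE (fun a ↦ a.curve.rootNumber = 1) ρ) (hρ : 0 < ρ) (hAρ : A < 27 + 54 * ρ)
    (hSchD : Φ.HasDensityOn (fun a ↦ ∀ (C : WeierstrassCurve.VariableChange ℚ)
      (hC : (C • a.curve).IsGloballyMinimal), @IsOrdinaryAt (C • a.curve) hC 3 _ →
      (C • a.curve).mordellWeilRank = 2 → ∀ Dh : PAdicHeightData (C • a.curve) 3, Dh.IsCanonical →
      SchneiderConjecture Dh) 1) :
    Φ.HasPositiveLowerDensityOn fun a ↦ a.IsMember ∧
      ∃ (C : WeierstrassCurve.VariableChange ℚ) (hC : (C • a.curve).IsGloballyMinimal),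
        @IsOrdinaryAt (C • a.curve) hC 3 _ ∧ (C • a.curve).mordellWeilRank = 2 ∧
        AddCommGroup.primaryComponent (C • a.curve).sha 3 = ⊥ ∧
        ∀ ⦃N : ℕ⦄ [NeZero N] (f : CuspForm (Gamma0 N) 2), IsNewformOf (C • a.curve) f →
          (padicLFunction f (@unitRoot (C • a.curve) hC 3 _ : ℚ_[3])).order = 2 := by
  have hGood := hasDensityOn_rank_torsionBy_of_irreducible Φ 3 hGen fun a h ↦ (hloc a h).1
  have hD9 := hasPositiveLowerDensityOn_selmerNine_of_cappedAverage Φ hIn.2.2.1 hGood hA hW hρ hAρ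
  exact countingDoor_leaf_of_local_selmerNine Φ hloc hIn hGen hSchD hD9

/-- **The leaf from Φ-local CAPPED data** (as `Theorems.leaf_of_local`, with the capped average).
[cite: BhargavaShankarTernary2015, §1 (first-moment method with parity)] -/
theorem leaf_of_local_capped (Φ : CongruenceFamily₂) (hL : Φ.IsLarge)
    (hloc : ∀ a : Params, Φ.Mem a → a.curve.HasIrreducibleModPGaloisRep 3 ∧
      ∀ (C : VariableChange ℚ) (hC : (C • a.curve).IsGloballyMinimal),
        @IsOrdinaryAt (C • a.curve) hC 3 _ ∧ ∃ ℓ : ℕ, ∃ _ : Fact ℓ.Prime, ℓ ≠ 3 ∧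
          (C • a.curve).HasMultiplicativeReductionAtPrime ℓ ∧
          ¬ 3 ∣ padicValInt ℓ (@minimalDiscriminantInt (C • a.curve) hC))
    (hIn : PublishedInputsAtThree) (hGen : Φ.HasDensityOn (fun a ↦ 2 ≤ a.curve.mordellWeilRank) 1)
    {A ρ : ℝ} (hA : Φ.AverageOnLE (fun a ↦ min (Nat.card (a.curve.selmerGroup 3) : ℝ) 81) A)
    (hW : Φ.DensityOnGE (fun a ↦ a.curve.rootNumber = 1) ρ) (hρ : 0 < ρ) (hAρ : A < 27 + 54 * ρ)
    (hSchD : Φ.HasDensityOn (fun a ↦ ∀ (C : WeierstrassCurve.VariableChange ℚ)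
      (hC : (C • a.curve).IsGloballyMinimal), @IsOrdinaryAt (C • a.curve) hC 3 _ →
      (C • a.curve).mordellWeilRank = 2 → ∀ Dh : PAdicHeightData (C • a.curve) 3, Dh.IsCanonical →
      SchneiderConjecture Dh) 1) :
    PAdicBSDRankTwoPositiveProportion :=
  ⟨Φ, hL, countingDoor_leaf_of_local_capped Φ hloc hIn hGen hA hW hρ hAρ hSchD⟩

/-- **I1cap ∧ I2 close the leaf, BY NAME** (with the landed I0 and I4loc): modulo the two fact
packs, the capped average `∀ Φ large, limsup avg min(#Sel₃, 81) ≤ 36` and I2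
`RootNumberPlusLowerDensityLargeF2` give `PAdicBSDRankTwoPositiveProportion` (`36 < 27 + 54ρ` iff
`ρ > 1/6`). [cite: BhargavaShankarTernary2015, §1 (first-moment method with parity)] -/
theorem pAdicBSDRankTwoPositiveProportion_of_cappedAverage (hIn : PublishedInputsAtThree)
    (hLF : LargeFamilyInputsF2)
    (h1 : ∀ Φ : CongruenceFamily₂, Φ.IsLarge →
      Φ.AverageOnLE (fun a ↦ min (Nat.card (a.curve.selmerGroup 3) : ℝ) 81) 36)
    (h2 : RootNumberPlusLowerDensityLargeF2) : PAdicBSDRankTwoPositiveProportion :=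
  pAdicBSDRankTwoPositiveProportion_of_selmerNineDensity hIn hLF
    (selmerNineDensity_of_cappedAverage hLF hIn.2.2.1 h1 h2)

/-- **The rev-11 chain recovered through the levers**: the published inputs, the large-family facts,
I1 and I2 give the leaf via `I1 ⇒ I1cap ⇒ (with I2) D9 ⇒ leaf` — the same conclusion as
`Theorems.countingBridgeLoc`, factored through the two weaker statements. [cite: BhargavaShankarTernary2015, §1 (first-moment method with parity)] -/
theorem pAdicBSDRankTwoPositiveProportion_of_selmerThreeAverageLargeF2 (hIn : PublishedInputsAtThree)
    (hLF : LargeFamilyInputsF2) (h1 : SelmerThreeAverageLargeF2)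
    (h2 : RootNumberPlusLowerDensityLargeF2) : PAdicBSDRankTwoPositiveProportion :=
  pAdicBSDRankTwoPositiveProportion_of_cappedAverage hIn hLF
    (selmerThreeCappedAverage_of_selmerThreeAverageLargeF2 h1) h2

/-! ### §5 What D9 gives for free: the positivity half of I2, and the weak leaf without Iwasawa theory -/

/-- **D9 contains the positivity half of I2.** Modulo the large-family facts and
Dokchitser–Dokchitser `3`-parity: if in every large subfamily of `F₂` with nonempty residue sets the
members with `#Sel₃(E_a) = 9` have positive lower density (D9), then in every such subfamily the
members with root number `+1` have positive lower density (the `ρ > 0` form of I2; what D9 does NOT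
contain is I2's threshold `ρ > 1/6` and I1's first moment). Trivial torsion for `100 %` is I0
(`Theorems.genericMembersLargeF2`). [cite: DokchitserDokchitserAnnals2010, Thm 1.4 (p-parity)] -/
theorem rootNumberPlusPositiveDensity_of_selmerNineDensity (hLF : LargeFamilyInputsF2)
    (hDD : even_selmerRank_sub_torsionRank_iff)
    (hD9 : ∀ Φ : CongruenceFamily₂, Φ.IsLarge → (∀ p : ℕ, p.Prime → (Φ.residues p).Nonempty) →
      Φ.HasPositiveLowerDensityOn (fun a ↦ Nat.card (a.curve.selmerGroup 3) = 9))
    (Φ : CongruenceFamily₂) (hL : Φ.IsLarge) (hne : ∀ p : ℕ, p.Prime → (Φ.residues p).Nonempty) :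
    Φ.HasPositiveLowerDensityOn (fun a ↦ a.curve.rootNumber = 1) := by
  have hGood := hasDensityOn_rank_torsionBy_of_torsionOrder Φ 3 (genericMembersLargeF2 hLF Φ hL hne)
  have hD : Φ.HasPositiveLowerDensityOn (fun a ↦ Nat.card (a.curve.selmerGroup 3) = 3 ^ 2) :=
    hasPositiveLowerDensityOn_mono Φ (hD9 Φ hL hne) fun a h ↦ h.trans (by norm_num)
  exact hasPositiveLowerDensityOn_rootNumber_of_card_selmerGroup_eq_sq Φ 3 hDD hGood hD

/-- **D9 gives the WEAK leaf with no Iwasawa theory.** Modulo the large-family facts ONLY (no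
`PublishedInputsAtThree`: no parity, no Mazur–Tate `σ`, no Schneider, no main conjecture): if in
every large subfamily of `F₂` with nonempty residue sets the members with `#Sel₃(E_a) = 9` have
positive lower density, then in every such subfamily the members with `rank E_a(ℚ) = 2` and
`Ш(E_a)[3^∞] = 0` have positive lower density — the route's KILL-CRITERIA fallback leaf «rank 2 ∧
Ш[3^∞] = 0 for a positive proportion», by pure counting (K1). [folklore] -/
theorem weakLeaf_of_selmerNineDensity (hLF : LargeFamilyInputsF2)
    (hD9 : ∀ Φ : CongruenceFamily₂, Φ.IsLarge → (∀ p : ℕ, p.Prime → (Φ.residues p).Nonempty) →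
      Φ.HasPositiveLowerDensityOn (fun a ↦ Nat.card (a.curve.selmerGroup 3) = 9))
    (Φ : CongruenceFamily₂) (hL : Φ.IsLarge) (hne : ∀ p : ℕ, p.Prime → (Φ.residues p).Nonempty) :
    Φ.HasPositiveLowerDensityOn (fun a ↦ a.IsMember ∧ a.curve.mordellWeilRank = 2 ∧
      AddCommGroup.primaryComponent a.curve.sha 3 = ⊥) := by
  have hGood := hasDensityOn_rank_torsionBy_of_torsionOrder Φ 3 (genericMembersLargeF2 hLF Φ hL hne)
  have hD : Φ.HasPositiveLowerDensityOn (fun a ↦ Nat.card (a.curve.selmerGroup 3) = 3 ^ 2) :=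
    hasPositiveLowerDensityOn_mono Φ (hD9 Φ hL hne) fun a h ↦ h.trans (by norm_num)
  exact hasPositiveLowerDensityOn_rank_two_sha_bot_of_card_selmerGroup_eq_sq Φ 3 hGood hD

/-- **The weak leaf on the whole family `F₂`** from D9 at `Φ = all` (large, every residue set is
`univ`), modulo the large-family facts only: a positive proportion of `F₂`, ordered by height, has
`rank = 2` and `Ш[3^∞] = 0`. [folklore] -/
theorem weakLeaf_all_of_selmerNineDensity (hLF : LargeFamilyInputsF2)
    (hD9 : ∀ Φ : CongruenceFamily₂, Φ.IsLarge → (∀ p : ℕ, p.Prime → (Φ.residues p).Nonempty) →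
      Φ.HasPositiveLowerDensityOn (fun a ↦ Nat.card (a.curve.selmerGroup 3) = 9)) :
    CongruenceFamily₂.all.HasPositiveLowerDensityOn (fun a ↦ a.IsMember ∧
      a.curve.mordellWeilRank = 2 ∧ AddCommGroup.primaryComponent a.curve.sha 3 = ⊥) :=
  weakLeaf_of_selmerNineDensity hLF hD9 _ CongruenceFamily₂.isLarge_all
    fun _ _ ↦ Set.univ_nonempty

end Summit.BirchSwinnertonDyer.BirchSwinnertonDyer.Theorems

end
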